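import Summits.BirchSwinnertonDyer.Rank1Residual.X11b.InterpolationCharacterSupply
import Summits.BirchSwinnertonDyer.Rank1Residual.X11b.BDPFrameUniquenessInt
import Summits.BirchSwinnertonDyer.Rank1Residual.X11b.BDPFrameUniqueness
import HarnessLib

/-!
# X11b, every odd prime `p`: the CHARACTER SUPPLY in the shape consumed by the cell's rigidity
# theorems — two sequences of everywhere-unramified interpolation characters `φ₀^{p^k}`, `φ₀^{2p^k}`
# with avatars through the anticyclotomic `κ` and values `x₀^{p^k} → 1`, `x₀^{p^k} ≠ 1` at `γ` —,
# and FRAME RIGIDITY AT FIXED PERIODS WITHOUT A SUPPLY HYPOTHESIS (route R1's STEP A unconditional)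

HONEST FRAMING (cell `b2b-bsdres`, run/shared/lean/b2b/bsd-rank1-residual/, verbatim in every
file): the goal of the cell is to DELETE the COMBINATION-SHAPED residual classes of the
Birch–Swinnerton-Dyer formula for ALL analytic-rank `≤ 1` elliptic curves over `ℚ` — "full BSD
formula for every rank `≤ 1` curve in class `C`" assembled STRICTLY from published theorems — so
that the rank-`≤ 1` remainder becomes exactly the CONSTRUCTION-SHAPED classes, which are TYPED
(missing-input `Prop`s), NOT attempted. This is not "finishing BSD". Sub-cell
`b2b-bsdres-multr1-p1` (X11b, route R1 at `p ≥ 5`, gen 25); THEOREMS ONLY (no definition, no named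
fact, no `sorry`); valid at every ODD prime `p`; nothing here changes a label; nothing at `p = 3` is
claimed (the `p = 3` instance is team x11b3's to consume, by import).

PROVENANCE AND CREDIT. The basic character is multr1-p2 GEN 25's
`LambdaSupply.exists_interpolationCharacter` (`X11b/InterpolationCharacterSupply.lean`: at every odd
`p`, imaginary quadratic `K`, anticyclotomic `κ` with topological generator `γ`, `ι : ℚ̄_p ≃ ℂ` — ONE
Hecke character `φ₀` unramified everywhere, of infinity type `(m, −m)` with `m > 0`, avatar `e ∘ ψ`
through `κ`, value `x₀ = ψ(γ)` a principal unit with `x₀^{p^k} ≠ 1`; built on x11b3's S24-a λ-supply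
ported to odd `p` by multr1-p2, `X11b.lambdaSupplyAt`), IMPORTED, not restated. This file only RAISES
IT TO POWERS (x11b3-p2/p7's rank-one currency lemmas `isPAdicAvatarOf_pow`,
`factorsThroughZp_unitsChar_pow`, `avatarValueAt_unitsChar_pow`, `HasInfinityType.pow_nat`,
`isUnramifiedAt_pow'`; x11b3-p7's `tendsto_pow_prime_pow_nhds_one`) and packages the two sequences
in the EXACT binder shape of x11b3's S27 reading (`Three.bdpValueAt₃_of_frameValue_of_supply`,
`X11b/Three/BDPValueRigidityReading.lean`, hypothesis `hsup`, with `3 ↦ p`) and of the frame-rigidity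
theorems of this sub-cell (`isBDPLFunction_unique_of_tendsto`, gen 22;
`R1.isBDPLFunctionInt_unique_of_tendsto`, gen 23).

## What this file proves (`p` an odd prime)

* §1 `tendsto_pow_prime_pow_padicComplex` (`‖x − 1‖ < 1` in `ℂ_p` ⟹ `x^{p^k} → 1`).
* §2 **`characterSupplyAt`** — for every imaginary quadratic `K`, `ι : ℚ̄_p ≃ ℂ`, anticyclotomic
  `κ` and `γ` with `κ γ = 1 ∈ ℤ_p`: `∃ m > 0, x₀ ∈ ℂ_p, φ φ' : ℕ → HeckeCharacter K, r r'` with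
  `x₀^{p^k} ≠ 1` (all `k`), `x₀^{p^k} → 1`, `φ_k` unramified everywhere of infinity type
  `(m p^k, −m p^k)` with avatar `r_k` through `κ` and `r_k(γ) = x₀^{p^k}`, and `φ'_k` likewise of type
  `(2m p^k, −2m p^k)` with `r'_k(γ) = x₀^{2p^k}` (`φ_k = φ₀^{p^k}`, `φ'_k = φ₀^{2p^k}`). At `p = 3`
  this is the `hsup` binder of `Three.bdpValueAt₃_of_frameValue_of_supply` VERBATIM.
* §3 FRAME RIGIDITY AT FIXED PERIODS, UNCONDITIONAL on such data: **`isBDPLFunction_unique`**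
  (two `L ∈ R₀⟦T⟧` with the same `IsBDPLFunction ι 𝔭 κ γ f Ω_K Ω_p ·` coincide),
  **`R1.isBDPLFunctionInt_unique`** (the same over `𝓞_{ℂ_p}⟦T⟧` = STEP A of the descent note of
  gen 23, now a theorem outright), `isBDPLFunction_forall_of_exists`,
  `R1.isBDPLFunctionInt_forall_of_exists` ("some `L` of the frame" = "every `L` of the frame").

## References

* [Castella2018] F. Castella, Math. Ann. 370 (2018), Thm. 3.1 (arXiv:1704.06608 p. 9).
* [CastellaHsieh2018] §3.3, Def. 3.5, Prop. 3.6.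
* [Washington1997] L. C. Washington, *Introduction to Cyclotomic Fields*, §5.1, §13.1.
-/

noncomputable section

open scoped Classical Topology
open Filter NumberField IsDedekindDomain Field PowerSeries
open Literature.NumberTheory.EllipticCurves Literature.NumberTheory.GaloisRepresentations
open Summit.BirchSwinnertonDyer.Rank1Residual.X11b.Three.LambdaSupply
open Summit.BirchSwinnertonDyer.Rank1Residual.X11b.LambdaSupply

namespace Summit.BirchSwinnertonDyer.Rank1Residual.X11b

variable {p : ℕ} [Fact p.Prime]

/-! ### §1 Principal units of `ℂ_p`: `x^{p^k} → 1` -/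

/-- **`x^{p^k} → 1` for `‖x − 1‖ < 1` in `ℂ_p`** (x11b3-p7's `tendsto_pow_prime_pow_nhds_one` for
the complete ultrametric `ℚ_p`-algebra `ℂ_p`). [cite: Washington1997, §5.1] -/
theorem tendsto_pow_prime_pow_padicComplex {x : ℂ_[p]} (hx : ‖x - 1‖ < 1) :
    Tendsto (fun k : ℕ ↦ x ^ p ^ k) atTop (𝓝 1) :=
  PadicUnits.tendsto_pow_prime_pow_nhds_one (p := p) (F := ℂ_[p]) (by rwa [← norm_neg, neg_sub])

/-! ### §2 The character supply in the consumers' shape -/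

/-- **THE CHARACTER SUPPLY at an odd prime `p`** — the hypothesis `hsup` of x11b3's S27 reading
`Three.bdpValueAt₃_of_frameValue_of_supply` with `3 ↦ p`, VERBATIM, now a theorem: for every imaginary
quadratic `K`, `ι : ℚ̄_p ≃ ℂ`, anticyclotomic `ℤ_p`-extension `κ` and `γ` with `κ γ = 1`, there are
`m > 0`, `x₀ ∈ ℂ_p` and sequences `φ_k, φ'_k` of Hecke characters of `K` UNRAMIFIED AT EVERY finite
place, of infinity types `(m p^k, −m p^k)`, `(2m p^k, −2m p^k)`, with `p`-adic avatars `r_k, r'_k`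
factoring through `κ` and values `r_k(γ) = x₀^{p^k}`, `r'_k(γ) = x₀^{2 p^k}`, where `x₀^{p^k} ≠ 1`
for all `k` and `x₀^{p^k} → 1`. Proof: `φ_k := φ₀^{p^k}`, `φ'_k := φ₀^{2p^k}`, `x₀ := ψ(γ)` for
multr1-p2's interpolation character `(φ₀, m, ψ)` (`LambdaSupply.exists_interpolationCharacter`).
[cite: Castella2018, Thm. 3.1 (arXiv:1704.06608 p. 9)] [cite: Washington1997, §13.1] -/
theorem characterSupplyAt (hp2 : p ≠ 2) :
    ∀ (K : Type) [Field K] [NumberField K] (ι : PadicAlgCl p ≃+* ℂ) (κ : ZpExtension K p)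
      (γ : Field.absoluteGaloisGroup K), IsImaginaryQuadratic K → κ.IsAnticyclotomic →
      κ.IsTopGenerator γ →
      ∃ (m : ℕ) (x₀ : ℂ_[p]) (φ φ' : ℕ → HeckeCharacter K)
        (r r' : ℕ → FramedGaloisRep K (PadicAlgCl p) 1),
        0 < m ∧ (∀ k, x₀ ^ p ^ k ≠ 1) ∧ Tendsto (fun k ↦ x₀ ^ p ^ k) atTop (𝓝 1) ∧
        (∀ k (v : HeightOneSpectrum (𝓞 K)), (φ k).IsUnramifiedAt v) ∧
        (∀ k, (φ k).HasInfinityType (fun _ ↦ ((m * p ^ k : ℕ) : ℤ))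
          (fun _ ↦ -((m * p ^ k : ℕ) : ℤ))) ∧
        (∀ k, IsPAdicAvatarOf ι (φ k) (r k)) ∧ (∀ k, FactorsThroughZp κ (r k)) ∧
        (∀ k, avatarValueAt (r k) γ = x₀ ^ p ^ k) ∧
        (∀ k (v : HeightOneSpectrum (𝓞 K)), (φ' k).IsUnramifiedAt v) ∧
        (∀ k, (φ' k).HasInfinityType (fun _ ↦ ((2 * m * p ^ k : ℕ) : ℤ))
          (fun _ ↦ -((2 * m * p ^ k : ℕ) : ℤ))) ∧
        (∀ k, IsPAdicAvatarOf ι (φ' k) (r' k)) ∧ (∀ k, FactorsThroughZp κ (r' k)) ∧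
        (∀ k, avatarValueAt (r' k) γ = x₀ ^ (2 * p ^ k)) := by
  intro K _ _ ι κ γ hK hκ hγ
  obtain ⟨φ₀, m, ψ, hm, hunr, hinf, hav, hfac, hx1, hne⟩ :=
    exists_interpolationCharacter hp2 ι K κ hK hκ γ hγ
  set e := (FramedRep.unitsContinuousMulEquivOfUnique (Fin 1) (PadicAlgCl p) :
    (PadicAlgCl p)ˣ →ₜ* GL (Fin 1) (PadicAlgCl p)) with he
  set x₀ : ℂ_[p] := avatarValueAt (e.comp ψ) γ with hx₀
  have hunr' : ∀ v : HeightOneSpectrum (𝓞 K), ((p : ℕ) : 𝓞 K) ∉ v.asIdeal → φ₀.IsUnramifiedAt v :=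
    fun v _ => hunr v
  -- the powers `φ₀^n`, `ψ^n`
  have hpow_unr : ∀ (n : ℕ) (v : HeightOneSpectrum (𝓞 K)), (φ₀ ^ n).IsUnramifiedAt v :=
    fun n v => isUnramifiedAt_pow' (hunr v) n
  have hpow_inf : ∀ n : ℕ, (φ₀ ^ n).HasInfinityType (fun _ ↦ ((m * n : ℕ) : ℤ))
      (fun _ ↦ -((m * n : ℕ) : ℤ)) := fun n => by
    have h := HasInfinityType.pow_nat hinf n
    convert h using 2 <;> push_cast <;> ring_nf
  have hpow_av : ∀ n : ℕ, IsPAdicAvatarOf ι (φ₀ ^ n) (e.comp (ψ ^ n)) :=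
    fun n => isPAdicAvatarOf_pow ι hav hunr' n
  have hpow_fac : ∀ n : ℕ, FactorsThroughZp κ (e.comp (ψ ^ n)) :=
    fun n => factorsThroughZp_unitsChar_pow κ hfac n
  have hpow_val : ∀ n : ℕ, avatarValueAt (e.comp (ψ ^ n)) γ = x₀ ^ n :=
    fun n => avatarValueAt_unitsChar_pow ψ γ n
  refine ⟨m, x₀, fun k => φ₀ ^ p ^ k, fun k => φ₀ ^ (2 * p ^ k), fun k => e.comp (ψ ^ p ^ k),
    fun k => e.comp (ψ ^ (2 * p ^ k)), hm, hne, tendsto_pow_prime_pow_padicComplex hx1,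
    fun k v => hpow_unr _ v, fun k => hpow_inf _, fun k => hpow_av _, fun k => hpow_fac _,
    fun k => hpow_val _, fun k v => hpow_unr _ v, fun k => ?_, fun k => hpow_av _, fun k => hpow_fac _,
    fun k => hpow_val _⟩
  have h := hpow_inf (2 * p ^ k)
  convert h using 3 <;> push_cast <;> ring

/-! ### §3 Frame rigidity at fixed periods, unconditional -/

section Rigidity

variable {K : Type} [Field K] [NumberField K] {N : ℕ} {ι : PadicAlgCl p ≃+* ℂ}
  {𝔭 : HeightOneSpectrum (𝓞 K)} {κ : ZpExtension K p} {γ : Field.absoluteGaloisGroup K}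
  {f : CuspForm (CongruenceSubgroup.Gamma0 N) 2} {ΩK : ℂ} {Ωp : ℂ_[p]}

/-- The supply in the one-sequence shape of the frame-rigidity theorems: interpolation data
`(φ_k, n_k, r_k)` (unramified, type `(n_k, −n_k)`, `n_k > 0`, avatars through `κ`) with
`r_k(γ) → 1` and `r_k(γ) ≠ 1` for all `k`. [cite: Castella2018, Thm. 3.1 (arXiv:1704.06608 p. 9)] -/
theorem exists_supply_tendsto (hp2 : p ≠ 2) (ι : PadicAlgCl p ≃+* ℂ) (κ : ZpExtension K p)
    (γ : Field.absoluteGaloisGroup K) (hK : IsImaginaryQuadratic K) (hκ : κ.IsAnticyclotomic)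
    (hγ : κ.IsTopGenerator γ) :
    ∃ (φ : ℕ → HeckeCharacter K) (n : ℕ → ℕ) (r : ℕ → FramedGaloisRep K (PadicAlgCl p) 1),
      (∀ k, 0 < n k) ∧ (∀ k (v : HeightOneSpectrum (𝓞 K)), (φ k).IsUnramifiedAt v) ∧
      (∀ k, (φ k).HasInfinityType (fun _ ↦ (n k : ℤ)) (fun _ ↦ -(n k : ℤ))) ∧
      (∀ k, IsPAdicAvatarOf ι (φ k) (r k)) ∧ (∀ k, FactorsThroughZp κ (r k)) ∧
      Tendsto (fun k ↦ avatarValueAt (r k) γ) atTop (𝓝 1) ∧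
      ∀ k, avatarValueAt (r k) γ ≠ 1 := by
  have hp : p.Prime := Fact.out
  obtain ⟨m, x₀, φ, -, r, -, hm, hne, hlim, hunr, hinf, hav, hfac, hval, -⟩ :=
    characterSupplyAt hp2 K ι κ γ hK hκ hγ
  refine ⟨φ, fun k => m * p ^ k, r, fun k => Nat.mul_pos hm (pow_pos hp.pos k), hunr, hinf, hav,
    hfac, ?_, fun k => ?_⟩
  · simpa only [hval] using hlim
  · rw [hval]; exact hne k

/-- **Frame rigidity at fixed periods for `IsBDPLFunction`, UNCONDITIONAL** (gen 22's
`isBDPLFunction_unique_of_tendsto` with its supply discharged): over an imaginary quadratic `K`, at an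
odd prime `p`, for an anticyclotomic `κ` with topological generator `γ`, two series `L, L' ∈ R₀⟦T⟧`
with the same interpolation data `IsBDPLFunction ι 𝔭 κ γ f Ω_K Ω_p ·` are EQUAL. In particular the
tree's interpolation predicate is not vacuous: it determines `L` once the periods are fixed.
[cite: Castella2018, Thm. 3.1 (arXiv:1704.06608 p. 9)]
[cite: CastellaHsieh2018, §3.3, Def. 3.5 and Prop. 3.6] -/
theorem isBDPLFunction_unique (hp2 : p ≠ 2) (hK : IsImaginaryQuadratic K) (hκ : κ.IsAnticyclotomic)
    (hγ : κ.IsTopGenerator γ) {L L' : UnrSeries p} (hL : IsBDPLFunction ι 𝔭 κ γ f ΩK Ωp L)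
    (hL' : IsBDPLFunction ι 𝔭 κ γ f ΩK Ωp L') : L = L' := by
  obtain ⟨φ, n, r, hn, hunr, hinf, hav, hfac, hlim, hne⟩ := exists_supply_tendsto hp2 ι κ γ hK hκ hγ
  exact isBDPLFunction_unique_of_tendsto hL hL' hn hunr hinf hav hfac hlim
    (Frequently.of_forall hne)

/-- **"Some `L` of the frame" = "every `L` of the frame", UNCONDITIONAL** (at fixed periods, for
`IsBDPLFunction` over an imaginary quadratic `K`, odd `p`, anticyclotomic `κ`).
[cite: Castella2018, Thm. 3.1 (arXiv:1704.06608 p. 9)] -/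
theorem isBDPLFunction_forall_of_exists (hp2 : p ≠ 2) (hK : IsImaginaryQuadratic K)
    (hκ : κ.IsAnticyclotomic) (hγ : κ.IsTopGenerator γ) {P : UnrSeries p → Prop}
    (hex : ∃ L, IsBDPLFunction ι 𝔭 κ γ f ΩK Ωp L ∧ P L) {L' : UnrSeries p}
    (hL' : IsBDPLFunction ι 𝔭 κ γ f ΩK Ωp L') : P L' := by
  obtain ⟨L, hL, hP⟩ := hex
  rwa [isBDPLFunction_unique hp2 hK hκ hγ hL hL'] at hP

/-- **Frame rigidity at fixed periods over `𝓞_{ℂ_p}⟦T⟧`, UNCONDITIONAL** — STEP A of route R1's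
descent note (gen 23's `R1.isBDPLFunctionInt_unique_of_tendsto`) with its supply discharged: two
`Q, Q' ∈ 𝓞_{ℂ_p}⟦T⟧` with the same data `R1.IsBDPLFunctionInt p ι 𝔭 κ γ f Ω_K Ω_p ·` coincide
(`K` imaginary quadratic, `p` odd, `κ` anticyclotomic with topological generator `γ`).
[cite: Castella2018, Thm. 3.1 (arXiv:1704.06608 p. 9)]
[cite: Hsieh2014, p. 7 (arXiv:1112.1580) (the receptacle `Z̄_p⟦Γ⁻⟧ ⊆ 𝓞_{ℂ_p}⟦T⟧`)] -/
theorem R1.isBDPLFunctionInt_unique (hp2 : p ≠ 2) (hK : IsImaginaryQuadratic K)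
    (hκ : κ.IsAnticyclotomic) (hγ : κ.IsTopGenerator γ) {Q Q' : PowerSeries 𝓞_ℂ_[p]}
    (hQ : R1.IsBDPLFunctionInt p ι 𝔭 κ γ f ΩK Ωp Q) (hQ' : R1.IsBDPLFunctionInt p ι 𝔭 κ γ f ΩK Ωp Q') :
    Q = Q' := by
  obtain ⟨φ, n, r, hn, hunr, hinf, hav, hfac, hlim, hne⟩ := exists_supply_tendsto hp2 ι κ γ hK hκ hγ
  exact R1.isBDPLFunctionInt_unique_of_tendsto hQ hQ' hn hunr hinf hav hfac hlim
    (Frequently.of_forall hne)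

/-- **"Some `Q` of the ♭-frame" = "every `Q` of the ♭-frame", UNCONDITIONAL** (fixed periods,
`R1.IsBDPLFunctionInt` over `𝓞_{ℂ_p}⟦T⟧`): e.g. the value at `𝟙` (`R1.BDPValueAtOneIntAt`) and the
main-conjecture equality (`R1.IMCEqIntAt`) of route R1's open input H3∃♭ hold for EVERY `Q` of a
frame as soon as they hold for one. [cite: Castella2018, Thm. 3.1 (arXiv:1704.06608 p. 9)] -/
theorem R1.isBDPLFunctionInt_forall_of_exists (hp2 : p ≠ 2) (hK : IsImaginaryQuadratic K)
    (hκ : κ.IsAnticyclotomic) (hγ : κ.IsTopGenerator γ) {P : PowerSeries 𝓞_ℂ_[p] → Prop}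
    (hex : ∃ Q, R1.IsBDPLFunctionInt p ι 𝔭 κ γ f ΩK Ωp Q ∧ P Q) {Q' : PowerSeries 𝓞_ℂ_[p]}
    (hQ' : R1.IsBDPLFunctionInt p ι 𝔭 κ γ f ΩK Ωp Q') : P Q' := by
  obtain ⟨Q, hQ, hP⟩ := hex
  rwa [R1.isBDPLFunctionInt_unique hp2 hK hκ hγ hQ hQ'] at hP

end Rigidity

end Summit.BirchSwinnertonDyer.Rank1Residual.X11b

end
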